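import Literature.NumberTheory.LFunctions.EulerProductLogDeriv
import Literature.NumberTheory.LFunctions.AbelianFrobeniusDensity
import Literature.NumberTheory.LFunctions.RayClassLSeriesNonvanishingLineProofs
import Literature.NumberTheory.LFunctions.DedekindZetaNonvanishing
import Literature.NumberTheory.LFunctions.WienerIkeharaProofs
import Literature.NumberTheory.LFunctions.LogWeightRemoval
import HarnessLib

/-!
# The prime ideal theorem for the fibres of an abelian Frobenius datum (natural density)

Topic `Literature/NumberTheory/LFunctions`; namespace `Literature.NumberTheory.LFunctions.AbelianDensity`
(that of `AbelianFrobeniusDensity.lean`, whose datum and notation — `artinSymbol`, `ArtinKillsRay`,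
`charCoeff`, `frobFiber`, `primeNormCount` — are reused).  Pure-proof file: theorems only, no definition,
no named fact.

`AbelianFrobeniusDensity.lean` proves the DIRICHLET-density equidistribution of the fibres
`X_τ = {𝔭 ∤ 𝔪 : f 𝔭 = τ}` of a map `f` from the primes of a number field `K` to a finite abelian group
`G` whose multiplicative extension kills the narrow ray `mod 𝔪` (Heilbronn, Ch. VIII of Cassels–Fröhlich,
§2, Note after Thm. 5, real-variable argument at `s → 1⁺`).  This file proves the NATURAL-density form —
the prime ideal theorem for the classes of such a datum:

* `tendsto_sum_log_mul_primeNormCount_frobFiber_div` — **`θ`-form**: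
  `(1/N) Σ_{N𝔭 ≤ N, 𝔭 ∈ X_τ} log N𝔭 → 1/|G|`;
* `tendsto_sum_primeNormCount_frobFiber_mul_log_div` — **`π`-form**:
  `#{𝔭 ∈ X_τ : N𝔭 ≤ N} · log N / N → 1/|G|`,

under the hypotheses (i) `𝔪 ≠ 0`, (ii) `ArtinKillsRay 𝔪 f` (so `𝔭 ↦ χ(f 𝔭)` is a ray class character
`mod 𝔪` for every character `χ` of `G`), (iii) every non-trivial `χ` has `χ(f 𝔭) ≠ 1` for some `𝔭 ∤ 𝔪`
(the `f 𝔭` generate `G`; equivalently the characters `𝔭 ↦ χ(f 𝔭)`, `χ ≠ 1`, are non-principal).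
For the Frobenius datum of an abelian extension `L/K` (Artin reciprocity supplies (ii)) this is the prime
ideal theorem for Frobenius classes, `π_σ(x) ∼ x/([L:K] log x)` (Landau 1918 for ideal classes; Artin 1923
/ Chebotarev for Frobenius classes), i.e. the abelian case of Chebotarev's theorem in natural-density form.

## Proof (Landau–Hecke–Wiener–Ikehara; Montgomery–Vaughan §8.3 for `K = ℚ`, §11.3 Cor. 11.17 main term)

With `a_n = Σ_{N𝔭 = n, 𝔭 ∈ X_τ} log N𝔭 ≥ 0`: for `Re s > 1`,
`Σ a_n n^{-s} = Σ_{𝔭 ∈ X_τ} log N𝔭 · N𝔭^{-s} = |G|⁻¹ Σ_χ χ(τ)⁻¹ D_χ(s)`,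
`D_χ(s) = Σ_{𝔭 ∤ 𝔪} χ(f𝔭) log N𝔭 · N𝔭^{-s}` (orthogonality, `sum_char_inv_mul`).  By
`EulerLogDeriv.exists_continuousOn_eq_tsum_logTerm_sub` each `D_χ(s) − k_χ/(s−1)` (`k_1 = 1`, `k_χ = 0`
otherwise) extends continuously to `Re s ≥ 1`: for `χ ≠ 1` because `L(s, χ∘f)` is entire (Hecke,
`exists_differentiable_eq_rayClassLSeries`) and `≠ 0` on `Re s = 1` (Landau,
`rayClassLSeries_entire_apply_ne_zero_of_re_eq_one`) and on `Re s > 1` (Euler product); for `χ = 1` because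
`(s−1)ζ_K(s)` is holomorphic and `≠ 0` on `Re s ≥ 1` (Landau 1903, `isLandauContinuation_dedekindZetaCont_holds'`,
`IsLandauContinuation.ne_zero_of_one_le_re`), the finitely many `𝔭 ∣ 𝔪` contributing an entire
correction.  Hence `Σ a_n n^{-s} − |G|⁻¹/(s−1)` is continuous on `Re s ≥ 1` and Wiener–Ikehara
(`WienerIkehara_holds`, MV Cor. 8.8) gives `Σ_{n ≤ N} a_n ∼ N/|G|`; the weight `log n` is removed by
`LogWeight.tendsto_sum_mul_log_div`.

## References

* E. Landau, *Über Ideale und Primideale in Idealklassen*, Math. Z. 2 (1918), 52–154 (prime ideal theorem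
  for classes). [folklore]
* H. Heilbronn, *Zeta-functions and L-functions*, Ch. VIII of Cassels–Fröhlich (1967), §3 Thm. 7 ff.
  [HeilbronnZetaL1967]
* H. L. Montgomery, R. C. Vaughan, *Multiplicative Number Theory I*, CUP 2007, Cor. 8.8, Thm. 8.9, Cor. 11.17.
  [MontgomeryVaughan2007]
* J. Neukirch, *Algebraic Number Theory* (1999), VII (13.2) (the Dirichlet-density form) and p. 543
  (natural density). [NeukirchANT1999]
-/

noncomputable section

open Filter NumberField IsDedekindDomain Complex Finset

open scoped _root_.Topology Classical

namespace Literature.NumberTheory.LFunctions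

namespace AbelianDensity

variable {K : Type*} [Field K] [NumberField K]

/-! ### Prime series as Dirichlet series over `ℕ` (regrouping by the norm) -/

section PrimeSeries

/-- There is no prime of norm `n < 2`: `primesOfNorm K n = ∅`. [folklore] -/
theorem primesOfNorm_eq_empty_of_lt_two {n : ℕ} (hn : n < 2) : primesOfNorm K n = ∅ := by
  ext v
  simp only [mem_primesOfNorm, Finset.notMem_empty, iff_false]
  intro h
  have := two_le_absNorm K v
  omega

/-- `primeNormCount K X n = 0` for `n < 2`. [folklore] -/
theorem primeNormCount_eq_zero_of_lt_two (X : Set (HeightOneSpectrum (𝓞 K))) {n : ℕ} (hn : n < 2) :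
    primeNormCount K X n = 0 := by
  rw [primeNormCount, primesOfNorm_eq_empty_of_lt_two hn, Finset.filter_empty, Finset.card_empty]

/-- The fibre of the norm map over `n` is the finite set `primesOfNorm K n`. [folklore] -/
theorem absNorm_preimage_singleton (n : ℕ) :
    (fun v : HeightOneSpectrum (𝓞 K) => Ideal.absNorm v.asIdeal) ⁻¹' {n} = ↑(primesOfNorm K n) := by
  ext v
  simp [mem_primesOfNorm]

/-- **Regrouping a weighted prime sum by the norm**: for a set `X` of primes and `Re s > 1`, the Dirichlet
series `Σ_n (log n · #{𝔭 ∈ X : N𝔭 = n}) n^{-s}` converges to `Σ_{𝔭 ∈ X} log N𝔭 · N𝔭^{-s}`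
(Mathlib `HasSum.tsum_fiberwise` along `𝔭 ↦ N𝔭`). [folklore] -/
theorem hasSum_term_log_mul_primeNormCount (X : Set (HeightOneSpectrum (𝓞 K))) {s : ℂ} (hs : 1 < s.re) :
    HasSum (fun n : ℕ => LSeries.term (fun n => ((Real.log n * (primeNormCount K X n : ℝ) : ℝ) : ℂ)) s n)
      (∑' v : HeightOneSpectrum (𝓞 K), (if v ∈ X then (1 : ℂ) else 0) *
        (Real.log ((Ideal.absNorm v.asIdeal : ℕ) : ℝ) : ℂ) * ((Ideal.absNorm v.asIdeal : ℕ) : ℂ) ^ (-s)) := by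
  set c : HeightOneSpectrum (𝓞 K) → ℂ := fun v => if v ∈ X then (1 : ℂ) else 0 with hcdef
  have hc : ∀ v, ‖c v‖ ≤ 1 := fun v => by
    rw [hcdef]; dsimp only; split_ifs <;> simp
  set F : HeightOneSpectrum (𝓞 K) → ℂ := fun v =>
    c v * (Real.log ((Ideal.absNorm v.asIdeal : ℕ) : ℝ) : ℂ) * ((Ideal.absNorm v.asIdeal : ℕ) : ℂ) ^ (-s) with hF
  have hFsum : Summable F := (EulerLogDeriv.summable_norm_logTerm hc hs).of_norm
  have h1 := hFsum.hasSum.tsum_fiberwise (fun v : HeightOneSpectrum (𝓞 K) => Ideal.absNorm v.asIdeal)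
  refine h1.congr_fun fun n => ?_
  -- the fibre sum over `N v = n`
  have hfiber : (∑' b : ↥((fun v : HeightOneSpectrum (𝓞 K) => Ideal.absNorm v.asIdeal) ⁻¹' {n}), F b) =
      ∑ v ∈ primesOfNorm K n, F v := by
    rw [_root_.tsum_subtype, tsum_eq_sum (s := primesOfNorm K n)]
    · refine Finset.sum_congr rfl fun v hv => Set.indicator_of_mem ?_ F
      rw [absNorm_preimage_singleton]; exact hv
    · intro v hv
      refine Set.indicator_of_notMem ?_ F
      rw [absNorm_preimage_singleton]; exact hv
  rw [hfiber]
  have hfib : ∀ v ∈ primesOfNorm K n, F v = c v * ((Real.log n : ℂ) * (n : ℂ) ^ (-s)) := by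
    intro v hv
    rw [mem_primesOfNorm] at hv
    rw [hF]; dsimp only; rw [hv, mul_assoc]
  rw [Finset.sum_congr rfl hfib, ← Finset.sum_mul]
  have hcount : ∑ v ∈ primesOfNorm K n, c v = (primeNormCount K X n : ℂ) := by
    rw [primeNormCount, Finset.natCast_card_filter]
  rw [hcount, LSeries.term]
  split_ifs with hn
  · rw [hn, primeNormCount_eq_zero_of_lt_two X (by norm_num)]; simp
  · rw [Complex.cpow_neg, div_eq_mul_inv]
    push_cast
    ring

/-- The Dirichlet series of `n ↦ log n · #{𝔭 ∈ X : N𝔭 = n}` converges for `Re s > 1`, with sum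
`Σ_{𝔭 ∈ X} log N𝔭 · N𝔭^{-s}`. [folklore] -/
theorem lseriesSummable_and_lseries_eq (X : Set (HeightOneSpectrum (𝓞 K))) {s : ℂ} (hs : 1 < s.re) :
    LSeriesSummable (fun n => ((Real.log n * (primeNormCount K X n : ℝ) : ℝ) : ℂ)) s ∧
      LSeries (fun n => ((Real.log n * (primeNormCount K X n : ℝ) : ℝ) : ℂ)) s =
        ∑' v : HeightOneSpectrum (𝓞 K), (if v ∈ X then (1 : ℂ) else 0) *
          (Real.log ((Ideal.absNorm v.asIdeal : ℕ) : ℝ) : ℂ) * ((Ideal.absNorm v.asIdeal : ℕ) : ℂ) ^ (-s) :=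
  ⟨(hasSum_term_log_mul_primeNormCount X hs).summable, (hasSum_term_log_mul_primeNormCount X hs).tsum_eq⟩

end PrimeSeries

/-! ### The two analytic inputs: continuous extension of `D_χ(s) − k_χ/(s−1)` to `Re s ≥ 1` -/

section Characters

variable {G : Type*} [CommGroup G] [Finite G]
variable {𝔪 : Ideal (𝓞 K)} {f : HeightOneSpectrum (𝓞 K) → G}

/-- **Non-trivial characters (Hecke–Landau).**  If the Artin symbol of `f` kills the ray `mod 𝔪 ≠ 0` and
`χ(f 𝔭₀) ≠ 1` for some `𝔭₀ ∤ 𝔪`, then `D_χ(s) = Σ_{𝔭 ∤ 𝔪} χ(f 𝔭) log N𝔭 · N𝔭^{-s}` extends continuously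
from `Re s > 1` to `Re s ≥ 1`: `L(s, χ ∘ f)` is an entire ray class `L`-series (Hecke, Neukirch VII (8.5))
without zeros on `Re s ≥ 1` (Euler product; Landau/Hecke `L(1+it, χ) ≠ 0`), and
`EulerLogDeriv.exists_continuousOn_eq_tsum_logTerm_sub` applies with `k = 0`.
[cite: NeukirchANT1999, Ch. VII §8 Thm. (8.5) and §13 Lemma (13.3)] -/
theorem exists_continuousOn_eq_tsum_charCoeff (h𝔪 : 𝔪 ≠ ⊥) (hray : ArtinKillsRay 𝔪 f)
    (χ : AddChar (Additive G) ℂ)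
    (hχ : ∃ v : HeightOneSpectrum (𝓞 K), ¬ 𝔪 ≤ v.asIdeal ∧ χ (Additive.ofMul (f v)) ≠ 1) :
    ∃ r : ℂ → ℂ, ContinuousOn r {s : ℂ | 1 ≤ s.re} ∧
      ∀ s : ℂ, 1 < s.re → r s =
        ∑' v : HeightOneSpectrum (𝓞 K), charCoeff 𝔪 f χ v *
          (Real.log ((Ideal.absNorm v.asIdeal : ℕ) : ℝ) : ℂ) * ((Ideal.absNorm v.asIdeal : ℕ) : ℂ) ^ (-s) := by
  have hψ : IsRayClassCharacter 𝔪 (charFun f χ) := isRayClassCharacter_toMulHom hray χ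
  have hnt : ∃ v : HeightOneSpectrum (𝓞 K), ¬ 𝔪 ≤ v.asIdeal ∧ charFun f χ v ≠ 1 := by
    obtain ⟨v, hv, hv1⟩ := hχ
    exact ⟨v, hv, by rwa [charFun, toMulHom_apply]⟩
  obtain ⟨g, hg, hgeq⟩ := exists_differentiable_eq_rayClassLSeries h𝔪 hψ hnt
  have hc : ∀ v, ‖charCoeff 𝔪 f χ v‖ ≤ 1 := norm_charCoeff_le 𝔪 f χ
  have hL : ∀ s : ℂ, 1 < s.re → HasProd (fun v : HeightOneSpectrum (𝓞 K) =>
      (1 - charCoeff 𝔪 f χ v * ((Ideal.absNorm v.asIdeal : ℕ) : ℂ) ^ (-s))⁻¹)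
      (rayClassLSeries 𝔪 (charFun f χ) s) := fun s hs =>
    hasProd_rayClassLSeries_rayClassPrimeValue h𝔪 (norm_charFun_le 𝔪 f χ) hs
  have hG0 : ∀ s : ℂ, 1 ≤ s.re → g s ≠ 0 := by
    intro s hs
    rcases eq_or_lt_of_le hs with h | h
    · exact rayClassLSeries_entire_apply_ne_zero_of_re_eq_one h𝔪 hψ hnt hg hgeq h.symm
    · rw [hgeq s h]
      exact EulerLogDeriv.ne_zero_of_hasProd hc h (hL s h)
  obtain ⟨r, hr, hreq⟩ := EulerLogDeriv.exists_continuousOn_eq_tsum_logTerm_sub hc 0 isOpen_univ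
    (Set.subset_univ _) hg.differentiableOn hG0 hL (fun s hs => by rw [pow_zero, one_mul]; exact hgeq s hs)
  refine ⟨r, hr, fun s hs => ?_⟩
  rw [hreq s hs, Nat.cast_zero, zero_div, sub_zero]

omit [Finite G] in
/-- **The trivial character (Landau).**  `Σ_{𝔭 ∤ 𝔪} log N𝔭 · N𝔭^{-s} − 1/(s−1)` extends continuously from
`Re s > 1` to `Re s ≥ 1`: `(s−1)ζ_K(s)` is holomorphic on `Re s > 1 − 1/[K:ℚ]` and non-zero on `Re s ≥ 1`
(Landau 1903; the tree's `isLandauContinuation_dedekindZetaCont_holds'` and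
`IsLandauContinuation.ne_zero_of_one_le_re`), the Euler product is `hasProd_dedekindEulerFactor_holds`, and
the finitely many `𝔭 ∣ 𝔪` contribute an entire function.  (Montgomery–Vaughan p. 267 / Thm. 8.9 for
`ζ_K`; Landau, Math. Ann. 56 (1903), Part II p. 666, properties 1)–2).)
[cite: MontgomeryVaughan2007, §8.4 Thm. 8.9 (p. 267)] -/
theorem exists_continuousOn_eq_tsum_charCoeff_zero (h𝔪 : 𝔪 ≠ ⊥) (f : HeightOneSpectrum (𝓞 K) → G) :
    ∃ r : ℂ → ℂ, ContinuousOn r {s : ℂ | 1 ≤ s.re} ∧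
      ∀ s : ℂ, 1 < s.re → r s =
        (∑' v : HeightOneSpectrum (𝓞 K), charCoeff 𝔪 f 0 v *
          (Real.log ((Ideal.absNorm v.asIdeal : ℕ) : ℝ) : ℂ) * ((Ideal.absNorm v.asIdeal : ℕ) : ℂ) ^ (-s)) -
          1 / (s - 1) := by
  -- Landau's continuation of `(s-1)ζ_K(s)`
  set Gz : ℂ → ℂ := Function.update (fun s : ℂ => (s - 1) * dedekindZetaCont K s) 1
    (NumberField.dedekindZeta_residue K : ℂ) with hGz
  have hLandau : NumberField.IsLandauContinuation K Gz := NumberField.isLandauContinuation_dedekindZetaCont_holds' K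
  have hc1 : ∀ v : HeightOneSpectrum (𝓞 K), ‖(fun _ => (1 : ℂ)) v‖ ≤ 1 := fun v => by simp
  have hEuler : ∀ s : ℂ, 1 < s.re → HasProd (fun v : HeightOneSpectrum (𝓞 K) =>
      (1 - (fun _ => (1 : ℂ)) v * ((Ideal.absNorm v.asIdeal : ℕ) : ℂ) ^ (-s))⁻¹) (NumberField.dedekindZeta K s) := by
    intro s hs
    refine (hasProd_dedekindEulerFactor_holds (K := K) hs).congr_fun fun v => ?_
    simp [dedekindEulerFactor]
  obtain ⟨r₁, hr₁, hr₁eq⟩ := EulerLogDeriv.exists_continuousOn_eq_tsum_logTerm_sub hc1 1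
    (NumberField.isOpen_landauHalfPlane K) (fun s hs => NumberField.mem_landauHalfPlane_of_one_le_re K hs)
    hLandau.differentiableOn (fun s hs => NumberField.IsLandauContinuation.ne_zero_of_one_le_re K hLandau hs) hEuler
    (fun s hs => by rw [pow_one]; exact hLandau.eq_mul s hs)
  -- the finitely many primes dividing `𝔪`
  have hfin : {v : HeightOneSpectrum (𝓞 K) | 𝔪 ≤ v.asIdeal}.Finite :=
    (Ideal.finite_factors h𝔪).subset fun v hv => Ideal.dvd_iff_le.mpr hv
  set S : Finset (HeightOneSpectrum (𝓞 K)) := hfin.toFinset with hS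
  have hSmem : ∀ v, v ∈ S ↔ 𝔪 ≤ v.asIdeal := fun v => by rw [hS, Set.Finite.mem_toFinset]; rfl
  set t : ℂ → HeightOneSpectrum (𝓞 K) → ℂ := fun s v =>
    (Real.log ((Ideal.absNorm v.asIdeal : ℕ) : ℝ) : ℂ) * ((Ideal.absNorm v.asIdeal : ℕ) : ℂ) ^ (-s) with ht
  have htcont : ∀ v, Continuous fun s => t s v := fun v => by
    have hn0 : ((Ideal.absNorm v.asIdeal : ℕ) : ℂ) ≠ 0 := by
      exact_mod_cast (absNorm_heightOneSpectrum_pos v).ne'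
    exact continuous_const.mul (continuous_neg.const_cpow (Or.inl hn0))
  refine ⟨fun s => r₁ s - ∑ v ∈ S, t s v, ?_, ?_⟩
  · exact hr₁.sub (continuous_finsetSum S fun v _ => htcont v).continuousOn
  · intro s hs
    have hsum1 : Summable fun v : HeightOneSpectrum (𝓞 K) => (1 : ℂ) * t s v := by
      have := (EulerLogDeriv.summable_norm_logTerm hc1 hs).of_norm
      refine this.congr fun v => ?_
      simp only [ht, mul_assoc]
    have hsum1' : Summable fun v : HeightOneSpectrum (𝓞 K) => t s v := by simpa using hsum1
    -- `charCoeff 𝔪 f 0 v · t v = t v - 1_S(v) t v`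
    have hpt : ∀ v, charCoeff 𝔪 f 0 v * (Real.log ((Ideal.absNorm v.asIdeal : ℕ) : ℝ) : ℂ) *
        ((Ideal.absNorm v.asIdeal : ℕ) : ℂ) ^ (-s) = t s v - (if v ∈ S then t s v else 0) := by
      intro v
      rw [charCoeff_apply, toMulHom_apply, AddChar.zero_apply, mul_assoc]
      by_cases hv : 𝔪 ≤ v.asIdeal
      · rw [if_pos hv, if_pos ((hSmem v).mpr hv)]; simp [ht]
      · rw [if_neg hv, if_neg (fun h => hv ((hSmem v).mp h))]; simp [ht]
    have hind : Summable fun v : HeightOneSpectrum (𝓞 K) => if v ∈ S then t s v else 0 :=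
      summable_of_ne_finset_zero (s := S) (fun v hv => if_neg hv)
    have hindsum : (∑' v : HeightOneSpectrum (𝓞 K), if v ∈ S then t s v else 0) = ∑ v ∈ S, t s v := by
      rw [tsum_eq_sum (s := S) (fun v hv => if_neg hv)]
      exact Finset.sum_congr rfl fun v hv => if_pos hv
    simp only [hpt]
    rw [hsum1'.tsum_sub hind, hindsum, hr₁eq s hs, Nat.cast_one]
    have : (∑' v : HeightOneSpectrum (𝓞 K), (1 : ℂ) * (Real.log ((Ideal.absNorm v.asIdeal : ℕ) : ℝ) : ℂ) *
        ((Ideal.absNorm v.asIdeal : ℕ) : ℂ) ^ (-s)) = ∑' v : HeightOneSpectrum (𝓞 K), t s v := by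
      refine tsum_congr fun v => ?_
      simp only [ht, one_mul]
    rw [this]
    ring

/-- Uniform packaging: for EVERY character `χ`, `D_χ(s) − k_χ/(s−1)` extends continuously to `Re s ≥ 1`,
`k_χ = 1` for the trivial character and `0` otherwise. [folklore] -/
theorem exists_continuousOn_eq_tsum_charCoeff_sub (h𝔪 : 𝔪 ≠ ⊥) (hray : ArtinKillsRay 𝔪 f)
    (hsep : ∀ χ : AddChar (Additive G) ℂ, χ ≠ 0 →
      ∃ v : HeightOneSpectrum (𝓞 K), ¬ 𝔪 ≤ v.asIdeal ∧ χ (Additive.ofMul (f v)) ≠ 1)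
    (χ : AddChar (Additive G) ℂ) :
    ∃ r : ℂ → ℂ, ContinuousOn r {s : ℂ | 1 ≤ s.re} ∧
      ∀ s : ℂ, 1 < s.re → r s =
        (∑' v : HeightOneSpectrum (𝓞 K), charCoeff 𝔪 f χ v *
          (Real.log ((Ideal.absNorm v.asIdeal : ℕ) : ℝ) : ℂ) * ((Ideal.absNorm v.asIdeal : ℕ) : ℂ) ^ (-s)) -
          (if χ = 0 then (1 : ℂ) else 0) / (s - 1) := by
  by_cases hχ : χ = 0
  · subst hχ
    obtain ⟨r, hr, hreq⟩ := exists_continuousOn_eq_tsum_charCoeff_zero (K := K) h𝔪 f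
    refine ⟨r, hr, fun s hs => ?_⟩
    rw [hreq s hs, if_pos rfl]
  · obtain ⟨r, hr, hreq⟩ := exists_continuousOn_eq_tsum_charCoeff h𝔪 hray χ (hsep χ hχ)
    refine ⟨r, hr, fun s hs => ?_⟩
    rw [hreq s hs, if_neg hχ, zero_div, sub_zero]

end Characters

/-! ### The prime ideal theorem for the fibres -/

section Main

variable {G : Type*} [CommGroup G] [Finite G]
variable {𝔪 : Ideal (𝓞 K)} {f : HeightOneSpectrum (𝓞 K) → G}

omit [NumberField K] in
/-- Orthogonality, pointwise: `Σ_χ χ(τ)⁻¹ a_χ(𝔭) = |G| · 1_{X_τ}(𝔭)`. [folklore] -/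
theorem sum_char_inv_mul_charCoeff (τ : G) (v : HeightOneSpectrum (𝓞 K)) :
    ∑ χ : AddChar (Additive G) ℂ, (χ (Additive.ofMul τ))⁻¹ * charCoeff 𝔪 f χ v =
      if v ∈ frobFiber 𝔪 f τ then (Nat.card G : ℂ) else 0 := by
  letI : Fintype G := Fintype.ofFinite G
  by_cases hm : 𝔪 ≤ v.asIdeal
  · have h0 : ∀ χ : AddChar (Additive G) ℂ, charCoeff 𝔪 f χ v = 0 := fun χ => by
      rw [charCoeff_apply, if_pos hm]
    simp only [h0, mul_zero, Finset.sum_const_zero]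
    rw [if_neg (fun h => h.1 hm)]
  · have h1 : ∀ χ : AddChar (Additive G) ℂ, charCoeff 𝔪 f χ v = toMulHom χ (f v) := fun χ => by
      rw [charCoeff_apply, if_neg hm]
    simp only [h1, sum_char_inv_mul]
    by_cases hft : f v = τ
    · rw [if_pos hft, if_pos ((mem_frobFiber 𝔪 f).mpr ⟨hm, hft⟩)]
    · rw [if_neg hft, if_neg (fun h => hft h.2)]

/-- **Prime ideal theorem for the fibres of an abelian Frobenius datum, `θ`-form.**  Let `𝔪 ≠ 0`, `G`
finite abelian, `f` a map from the primes of `K` to `G` whose Artin symbol kills the narrow ray `mod 𝔪`,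
and suppose every non-trivial character `χ` of `G` has `χ(f 𝔭) ≠ 1` for some `𝔭 ∤ 𝔪`.  Then for every
`τ ∈ G`: `(1/N) Σ_{𝔭 ∈ X_τ, N𝔭 ≤ N} log N𝔭 → 1/|G|`, i.e. `θ(N; X_τ) ∼ N/|G|` — Wiener–Ikehara applied to
`a_n = Σ_{N𝔭 = n, 𝔭 ∈ X_τ} log N𝔭`, whose Dirichlet series is `|G|⁻¹ Σ_χ χ(τ)⁻¹ D_χ(s)`.
[cite: MontgomeryVaughan2007, §8.3 Cor. 8.8 and §11.3 Cor. 11.17 (main term)] -/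
theorem tendsto_sum_log_mul_primeNormCount_frobFiber_div (h𝔪 : 𝔪 ≠ ⊥) (hray : ArtinKillsRay 𝔪 f)
    (hsep : ∀ χ : AddChar (Additive G) ℂ, χ ≠ 0 →
      ∃ v : HeightOneSpectrum (𝓞 K), ¬ 𝔪 ≤ v.asIdeal ∧ χ (Additive.ofMul (f v)) ≠ 1)
    (τ : G) :
    Tendsto (fun N : ℕ => (∑ n ∈ Icc 1 N, Real.log n * (primeNormCount K (frobFiber 𝔪 f τ) n : ℝ)) / N)
      atTop (𝓝 (1 / Nat.card G)) := by
  letI : Fintype G := Fintype.ofFinite G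
  set a : ℕ → ℝ := fun n => Real.log n * (primeNormCount K (frobFiber 𝔪 f τ) n : ℝ) with ha
  have ha0 : ∀ n, 0 ≤ a n := fun n => by
    rcases Nat.lt_or_ge n 2 with h | h
    · rw [ha]; dsimp only; rw [primeNormCount_eq_zero_of_lt_two _ h]; simp
    · exact mul_nonneg (Real.log_nonneg (by exact_mod_cast (by omega : 1 ≤ n))) (Nat.cast_nonneg _)
  have hcard0 : (Nat.card G : ℂ) ≠ 0 := Nat.cast_ne_zero.mpr Nat.card_pos.ne'
  have hcard0' : (Nat.card G : ℝ) ≠ 0 := Nat.cast_ne_zero.mpr Nat.card_pos.ne'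
  -- the continuous extensions `r_χ`
  choose r hrc hreq using exists_continuousOn_eq_tsum_charCoeff_sub (K := K) h𝔪 hray hsep
  -- notation for the weighted term
  set t : ℂ → HeightOneSpectrum (𝓞 K) → ℂ := fun s v =>
    (Real.log ((Ideal.absNorm v.asIdeal : ℕ) : ℝ) : ℂ) * ((Ideal.absNorm v.asIdeal : ℕ) : ℂ) ^ (-s) with ht
  -- Step 1: the Dirichlet series of `a` is `|G|⁻¹ Σ_χ χ(τ)⁻¹ D_χ(s)`
  have hLS : ∀ s : ℂ, 1 < s.re → LSeriesSummable (fun n => (a n : ℂ)) s ∧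
      LSeries (fun n => (a n : ℂ)) s =
        (Nat.card G : ℂ)⁻¹ * ∑ χ : AddChar (Additive G) ℂ, (χ (Additive.ofMul τ))⁻¹ *
          ∑' v : HeightOneSpectrum (𝓞 K), charCoeff 𝔪 f χ v *
            (Real.log ((Ideal.absNorm v.asIdeal : ℕ) : ℝ) : ℂ) * ((Ideal.absNorm v.asIdeal : ℕ) : ℂ) ^ (-s) := by
    intro s hs
    obtain ⟨hsum, hLeq⟩ := lseriesSummable_and_lseries_eq (frobFiber 𝔪 f τ) hs
    refine ⟨hsum, ?_⟩
    rw [hLeq]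
    -- `HasSum` over `v` for each `χ`, combined over `χ`
    have hχsum : ∀ χ : AddChar (Additive G) ℂ, HasSum (fun v : HeightOneSpectrum (𝓞 K) =>
        charCoeff 𝔪 f χ v * (Real.log ((Ideal.absNorm v.asIdeal : ℕ) : ℝ) : ℂ) *
          ((Ideal.absNorm v.asIdeal : ℕ) : ℂ) ^ (-s))
        (∑' v : HeightOneSpectrum (𝓞 K), charCoeff 𝔪 f χ v *
          (Real.log ((Ideal.absNorm v.asIdeal : ℕ) : ℝ) : ℂ) * ((Ideal.absNorm v.asIdeal : ℕ) : ℂ) ^ (-s)) :=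
      fun χ => (EulerLogDeriv.summable_norm_logTerm (norm_charCoeff_le 𝔪 f χ) hs).of_norm.hasSum
    have hcomb := hasSum_sum fun (χ : AddChar (Additive G) ℂ) (_ : χ ∈ Finset.univ) =>
      (hχsum χ).mul_left ((χ (Additive.ofMul τ))⁻¹)
    have hpt : ∀ v : HeightOneSpectrum (𝓞 K),
        ∑ χ : AddChar (Additive G) ℂ, (χ (Additive.ofMul τ))⁻¹ * (charCoeff 𝔪 f χ v *
          (Real.log ((Ideal.absNorm v.asIdeal : ℕ) : ℝ) : ℂ) * ((Ideal.absNorm v.asIdeal : ℕ) : ℂ) ^ (-s)) =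
        (Nat.card G : ℂ) * ((if v ∈ frobFiber 𝔪 f τ then (1 : ℂ) else 0) *
          (Real.log ((Ideal.absNorm v.asIdeal : ℕ) : ℝ) : ℂ) * ((Ideal.absNorm v.asIdeal : ℕ) : ℂ) ^ (-s)) := by
      intro v
      have h1 : ∀ χ : AddChar (Additive G) ℂ, (χ (Additive.ofMul τ))⁻¹ * (charCoeff 𝔪 f χ v *
          (Real.log ((Ideal.absNorm v.asIdeal : ℕ) : ℝ) : ℂ) * ((Ideal.absNorm v.asIdeal : ℕ) : ℂ) ^ (-s)) =
          ((χ (Additive.ofMul τ))⁻¹ * charCoeff 𝔪 f χ v) * t s v := fun χ => by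
        simp only [ht]; ring
      simp only [h1]
      rw [← Finset.sum_mul, sum_char_inv_mul_charCoeff τ v]
      by_cases hv : v ∈ frobFiber 𝔪 f τ
      · rw [if_pos hv, if_pos hv]; simp only [ht]; ring
      · rw [if_neg hv, if_neg hv]; simp
    simp only [hpt] at hcomb
    have hind : HasSum (fun v : HeightOneSpectrum (𝓞 K) => (Nat.card G : ℂ) *
        ((if v ∈ frobFiber 𝔪 f τ then (1 : ℂ) else 0) *
        (Real.log ((Ideal.absNorm v.asIdeal : ℕ) : ℝ) : ℂ) * ((Ideal.absNorm v.asIdeal : ℕ) : ℂ) ^ (-s)))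
        ((Nat.card G : ℂ) * ∑' v : HeightOneSpectrum (𝓞 K), (if v ∈ frobFiber 𝔪 f τ then (1 : ℂ) else 0) *
          (Real.log ((Ideal.absNorm v.asIdeal : ℕ) : ℝ) : ℂ) * ((Ideal.absNorm v.asIdeal : ℕ) : ℂ) ^ (-s)) := by
      have hc : ∀ v : HeightOneSpectrum (𝓞 K), ‖(if v ∈ frobFiber 𝔪 f τ then (1 : ℂ) else 0)‖ ≤ 1 := fun v => by
        split_ifs <;> simp
      exact (EulerLogDeriv.summable_norm_logTerm hc hs).of_norm.hasSum.mul_left _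
    have heq := hcomb.unique hind
    rw [← mul_right_inj' hcard0, ← mul_assoc, mul_inv_cancel₀ hcard0, one_mul]
    exact heq.symm
  -- Step 2: the continuous extension `r = |G|⁻¹ Σ_χ χ(τ)⁻¹ r_χ`
  set R : ℂ → ℂ := fun s => (Nat.card G : ℂ)⁻¹ *
    ∑ χ : AddChar (Additive G) ℂ, (χ (Additive.ofMul τ))⁻¹ * r χ s with hR
  have hRc : ContinuousOn R {s : ℂ | 1 ≤ s.re} :=
    continuousOn_const.mul (continuousOn_finsetSum Finset.univ fun χ _ => continuousOn_const.mul (hrc χ))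
  have hReq : ∀ s : ℂ, 1 < s.re → R s = LSeries (fun n => (a n : ℂ)) s - ((1 / Nat.card G : ℝ) : ℂ) / (s - 1) := by
    intro s hs
    rw [(hLS s hs).2]
    have hpole : ∑ χ : AddChar (Additive G) ℂ, (χ (Additive.ofMul τ))⁻¹ *
        ((if χ = 0 then (1 : ℂ) else 0) / (s - 1)) = 1 / (s - 1) := by
      rw [Finset.sum_eq_single (0 : AddChar (Additive G) ℂ)]
      · simp
      · intro χ _ hχ; rw [if_neg hχ, zero_div, mul_zero]
      · intro h; exact absurd (Finset.mem_univ _) h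
    have hsplit : ∑ χ : AddChar (Additive G) ℂ, (χ (Additive.ofMul τ))⁻¹ *
        ∑' v : HeightOneSpectrum (𝓞 K), charCoeff 𝔪 f χ v *
          (Real.log ((Ideal.absNorm v.asIdeal : ℕ) : ℝ) : ℂ) * ((Ideal.absNorm v.asIdeal : ℕ) : ℂ) ^ (-s) =
        ∑ χ : AddChar (Additive G) ℂ, (χ (Additive.ofMul τ))⁻¹ * r χ s + 1 / (s - 1) := by
      rw [← hpole, ← Finset.sum_add_distrib]
      refine Finset.sum_congr rfl fun χ _ => ?_
      rw [hreq χ s hs]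
      ring
    rw [hR, hsplit]
    push_cast
    field_simp
    ring
  -- Step 3: Wiener–Ikehara
  have hWI := WienerIkehara_holds a (1 / Nat.card G) ha0 (fun s hs => (hLS s hs).1) ⟨R, hRc, hReq⟩
  -- Step 4: `o(N)` to the limit of the quotient
  have h1 : Tendsto (fun N : ℕ => (∑ n ∈ Icc 1 N, a n - 1 / (Nat.card G : ℝ) * N) / N) atTop (𝓝 0) := by
    have := hWI.tendsto_div_nhds_zero
    simpa using this
  have h2 := h1.add_const (1 / (Nat.card G : ℝ))
  rw [zero_add] at h2
  refine h2.congr' ?_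
  filter_upwards [eventually_ge_atTop 1] with N hN
  have hN : (N : ℝ) ≠ 0 := by exact_mod_cast (by omega : N ≠ 0)
  field_simp
  ring

/-- **Prime ideal theorem for the fibres of an abelian Frobenius datum, `π`-form.**  Under the hypotheses
of `tendsto_sum_log_mul_primeNormCount_frobFiber_div`, for every `τ ∈ G`:
`#{𝔭 ∈ X_τ : N𝔭 ≤ N} · log N / N → 1/|G|` (the count written as `Σ_{n ≤ N} #{𝔭 ∈ X_τ : N𝔭 = n}`), i.e.
`π(N; X_τ) ∼ N/(|G| log N)`: the primes `𝔭 ∤ 𝔪` with `f 𝔭 = τ` have NATURAL density `1/|G|`.  For the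
Frobenius datum of an abelian extension this is Chebotarev's theorem (abelian case) in the natural-density
form of Serre 1981, §2.1, eq. (9). [cite: MontgomeryVaughan2007, §8.3 Cor. 8.8 with (8.29); §11.3 Cor. 11.17] -/
theorem tendsto_sum_primeNormCount_frobFiber_mul_log_div (h𝔪 : 𝔪 ≠ ⊥) (hray : ArtinKillsRay 𝔪 f)
    (hsep : ∀ χ : AddChar (Additive G) ℂ, χ ≠ 0 →
      ∃ v : HeightOneSpectrum (𝓞 K), ¬ 𝔪 ≤ v.asIdeal ∧ χ (Additive.ofMul (f v)) ≠ 1)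
    (τ : G) :
    Tendsto (fun N : ℕ => (∑ n ∈ Icc 1 N, (primeNormCount K (frobFiber 𝔪 f τ) n : ℝ)) * Real.log N / N)
      atTop (𝓝 (1 / Nat.card G)) :=
  LogWeight.tendsto_sum_mul_log_div (b := fun n => (primeNormCount K (frobFiber 𝔪 f τ) n : ℝ))
    (fun n => Nat.cast_nonneg _)
    (by rw [primeNormCount_eq_zero_of_lt_two _ (by norm_num)]; simp)
    (tendsto_sum_log_mul_primeNormCount_frobFiber_div h𝔪 hray hsep τ)

end Main

end AbelianDensity

end Literature.NumberTheory.LFunctions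

end
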